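import Mathlib
import Literature.NumberTheory.LFunctions.Zhang2022.Section11AFEObjects
import Literature.NumberTheory.LFunctions.Zhang2022.Section6LFunctionStripGrowth
import HarnessLib

/-!
# Zhang (2022) §11, proof of Lemma 11.2 for `χψ` — the integrands on the line `u = −1` are
# absolutely integrable (continuity of `Z(·,χψ)` left of `σ = 1`, polynomial growth × Gaussian)

Topic `Literature/NumberTheory/LFunctions/Zhang2022` (Landau–Siegel audit tree; verdict-neutral).
Y. Zhang, *Discrete mean estimates and the Landau–Siegel zero*, arXiv:2211.02515v1 (2022)
[Zhang2022LandauSiegel] — **an unrefereed manuscript under adjudication** (campaign D-0069; nothing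
here bears on Theorems 1–2 or on Landau–Siegel zeros). Companion of `Section11AFEObjects`; the
tacit input of `Z22:Lem6.1.pf` (tex L1754, "The proof of (6.1) is therefore reduced to showing
(6.3)": splitting the line integral `∫_{(−1)}` requires the pieces to be integrable) for `χψ`.
PROVED: `continuousAt_Zfac_of_re_lt_one` (`Z(·,θ)` is continuous on `Re z < 1`: no pole of
`Γ((1−z)/2)`, `Γ((2−z)/2)`; `1/Γ` entire), `continuous_tailPc_neg_one` (the reflected tail is a
uniformly convergent series on `u = −1`, `≤ Σn^{−3/2}`), `norm_kern_neg_one_le`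
(`|X^wω₁(w)/w| ≤ X⁻¹e^{1/4𝓛³⁰}e^{−v²/4𝓛³⁰}`), and `integrable_integrandHead/Tail/Main` — the (6.3),
(6.2), (6.4) integrands for `χψ` are integrable along `u = −1` (polynomial growth of
`|Z(−1/2+iτ,χψ)|`, the tree's `StripGrowth.exists_norm_Zfac_le`, against the Gaussian `ω₁`).

## References

* Y. Zhang, arXiv:2211.02515v1 (2022), §6 proof of Lemma 6.1, pp. 31–32; §11 p. 65; §2 (2.4).
  [cite: Zhang2022LandauSiegel, §6 Lemma 6.1 (proof); §11 Lemma 11.2]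
-/

noncomputable section

open Complex Real ComplexConjugate MeasureTheory Set Filter Topology

namespace Literature.NumberTheory.LFunctions.Zhang2022.Section11AFE

open Skeleton GaussWeight Section6Statements

/-! ## §1. Block (c) PROVED: the functional-equation split on `u = −1` and the linearity of the
line integrals (continuity of `Z(·,χψ)` left of `σ = 1`, polynomial growth × Gaussian) -/

section BlockC

variable {D : ℕ} [NeZero D] (χ : DirichletCharacter ℂ D) (x : Chr D)

/-- `Z(·,θ)` is continuous at every point with `Re z < 1` (no pole of `Γ((1−z)/2)`, `Γ((2−z)/2)`
there; `1/Γ` is entire). [cite: Zhang2022LandauSiegel, §2 (2.2)–(2.4)] -/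
theorem continuousAt_Zfac_of_re_lt_one {k : ℕ} [NeZero k] (θ : DirichletCharacter ℂ k) {z : ℂ}
    (hz : z.re < 1) : ContinuousAt (GammaFactor.Zfac θ) z := by
  have hπ : (π : ℂ) ≠ 0 := Complex.ofReal_ne_zero.mpr Real.pi_ne_zero
  have hk : (k : ℂ) ≠ 0 := Nat.cast_ne_zero.mpr (NeZero.ne k)
  have c1 : ContinuousAt (fun w : ℂ => (π : ℂ) ^ (w - 1 / 2)) z :=
    ContinuousAt.comp (g := fun w : ℂ => (π : ℂ) ^ w) (continuousAt_const_cpow hπ)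
      (continuousAt_id.sub continuousAt_const)
  have c2 : ContinuousAt (fun w : ℂ => (k : ℂ) ^ (-w)) z :=
    ContinuousAt.comp (g := fun w : ℂ => (k : ℂ) ^ w) (continuousAt_const_cpow hk) continuousAt_id.neg
  have cG : ∀ a : ℂ, z.re < a.re → ContinuousAt (fun w : ℂ => Complex.Gamma ((a - w) / 2)) z := by
    intro a ha
    have hne : ∀ m : ℕ, (a - z) / 2 ≠ -(m : ℂ) := by
      intro m h
      have h1 := congrArg Complex.re h
      simp only [Complex.div_ofNat_re, Complex.sub_re, Complex.neg_re, Complex.natCast_re] at h1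
      have : (0 : ℝ) ≤ m := Nat.cast_nonneg m
      linarith
    exact ContinuousAt.comp (g := Complex.Gamma) (Complex.differentiableAt_Gamma _ hne).continuousAt
      ((continuousAt_const.sub continuousAt_id).div_const _)
  have cInv : ∀ b : ℂ, ContinuousAt (fun w : ℂ => (Complex.Gamma ((b + w) / 2))⁻¹) z := by
    intro b
    exact ContinuousAt.comp (g := fun w : ℂ => (Complex.Gamma w)⁻¹)
      Complex.differentiable_one_div_Gamma.continuous.continuousAt
      ((continuousAt_const.add continuousAt_id).div_const _)
  by_cases he : θ.Even
  · have hZ : GammaFactor.Zfac θ = fun w => GammaFactor.tau θ * (π : ℂ) ^ (w - 1 / 2) *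
        (k : ℂ) ^ (-w) * Complex.Gamma ((1 - w) / 2) * (Complex.Gamma (w / 2))⁻¹ := by
      funext w; simp [GammaFactor.Zfac, he]
    rw [hZ]
    have cG1 := cG 1 (by simp only [Complex.one_re]; linarith)
    have cI0 : ContinuousAt (fun w : ℂ => (Complex.Gamma (w / 2))⁻¹) z := by
      have := cInv 0; simpa only [zero_add] using this
    exact (((continuousAt_const.mul c1).mul c2).mul cG1).mul cI0
  · have hZ : GammaFactor.Zfac θ = fun w => -I * GammaFactor.tau θ * (π : ℂ) ^ (w - 1 / 2) *
        (k : ℂ) ^ (-w) * Complex.Gamma ((2 - w) / 2) * (Complex.Gamma ((1 + w) / 2))⁻¹ := by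
      funext w; simp [GammaFactor.Zfac, he]
    rw [hZ]
    have cG2 := cG 2 (by
      have : (2 : ℂ).re = 2 := by norm_num
      rw [this]; linarith)
    exact (((continuousAt_const.mul c1).mul c2).mul cG2).mul (cInv 1)

/-- `v ↦ Z(s + c + iv, χψ)` is continuous when `Re s + c < 1`. [cite: Zhang2022LandauSiegel, §2 (2.2)] -/
theorem continuous_Zpc_line {s : ℂ} {c : ℝ} (hsc : s.re + c < 1) :
    Continuous fun v : ℝ => Zpc χ x (s + (((c : ℝ) : ℂ) + (v : ℂ) * I)) := by
  refine continuous_iff_continuousAt.mpr fun v => ?_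
  have hre : (s + (((c : ℝ) : ℂ) + (v : ℂ) * I)).re < 1 := by simp; linarith
  exact ContinuousAt.comp (g := Zpc χ x) (continuousAt_Zfac_of_re_lt_one _ hre)
    (by fun_prop : Continuous fun v : ℝ => s + (((c : ℝ) : ℂ) + (v : ℂ) * I)).continuousAt

omit [NeZero D] in
/-- `v ↦ head(c + iv)` is continuous (a finite Dirichlet polynomial).
[cite: Zhang2022LandauSiegel, §6 p. 31] -/
theorem continuous_headPc_line (N : ℝ) (s : ℂ) (c : ℝ) :
    Continuous fun v : ℝ => headPc χ x N s (((c : ℝ) : ℂ) + (v : ℂ) * I) := by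
  unfold headPc
  refine continuous_finsetSum _ fun n hn => ?_
  have hn0 : (n : ℂ) ≠ 0 := by
    have := (Finset.mem_Ico.mp hn).1; exact_mod_cast (by omega : n ≠ 0)
  exact continuous_const.mul (Continuous.const_cpow (by fun_prop) (Or.inl hn0))

omit [NeZero D] in
/-- On `u = −1`, `σ = 1/2`: `|χψ̄(n)n^{−(1−s−w)}| ≤ n^{−3/2}`. [cite: Zhang2022LandauSiegel, §6 p. 31] -/
theorem norm_refl_term_le {s : ℂ} (hs : s.re = 1 / 2) (n : ℕ) (v : ℝ) :
    ‖conj (pc χ x n) * (n : ℂ) ^ (-(1 - s - (((-1 : ℝ) : ℂ) + (v : ℂ) * I)))‖ ≤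
      (n : ℝ) ^ (-(3 / 2 : ℝ)) := by
  have hre : (-(1 - s - (((-1 : ℝ) : ℂ) + (v : ℂ) * I))).re = -(3 / 2 : ℝ) := by
    simp [hs]; norm_num
  rcases Nat.eq_zero_or_pos n with rfl | hn
  · have hne : (-(1 - s - (((-1 : ℝ) : ℂ) + (v : ℂ) * I))) ≠ 0 := by
      intro h; have := congrArg Complex.re h; rw [hre] at this; norm_num at this
    rw [Nat.cast_zero, Complex.zero_cpow hne, mul_zero, norm_zero, Nat.cast_zero,
      Real.zero_rpow (by norm_num : (-(3 / 2 : ℝ)) ≠ 0)]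
  · rw [norm_mul, Complex.norm_natCast_cpow_of_pos hn, hre, Complex.norm_conj]
    have h1 : ‖pc χ x n‖ ≤ 1 := by
      rw [pc, norm_mul]; exact mul_le_one₀ (x.ψ.norm_le_one _) (norm_nonneg _) (χ.norm_le_one _)
    have h0 : 0 ≤ (n : ℝ) ^ (-(3 / 2 : ℝ)) := Real.rpow_nonneg (Nat.cast_nonneg n) _
    nlinarith

omit [NeZero D] in
/-- `|head(−1+iv)| ≤ ⌈N⌉` and `v ↦ tail(−1+iv)` is continuous with `|tail(−1+iv)| ≤ Σ_n n^{−3/2}`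
(`σ = 1/2`). [cite: Zhang2022LandauSiegel, §6 p. 32 ("`Σ_{n≥T³} … ≪ T^{3u+1/2}`")] -/
theorem norm_headPc_neg_one_le {s : ℂ} (hs : s.re = 1 / 2) (N : ℝ) (v : ℝ) :
    ‖headPc χ x N s (((-1 : ℝ) : ℂ) + (v : ℂ) * I)‖ ≤ ⌈N⌉₊ := by
  unfold headPc
  refine (norm_sum_le _ _).trans ?_
  calc ∑ n ∈ Finset.Ico 1 ⌈N⌉₊, ‖conj (pc χ x n) * (n : ℂ) ^ (-(1 - s - (((-1 : ℝ) : ℂ) + (v : ℂ) * I)))‖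
      ≤ ∑ n ∈ Finset.Ico 1 ⌈N⌉₊, (1 : ℝ) := by
        refine Finset.sum_le_sum fun n hn => ?_
        have hn1 : 1 ≤ n := (Finset.mem_Ico.mp hn).1
        refine (norm_refl_term_le χ x hs n v).trans ?_
        exact Real.rpow_le_one_of_one_le_of_nonpos (by exact_mod_cast hn1) (by norm_num)
    _ = ((⌈N⌉₊ - 1 : ℕ) : ℝ) := by simp
    _ ≤ ⌈N⌉₊ := by exact_mod_cast Nat.sub_le _ _

omit [NeZero D] in
/-- The reflected tail on `u = −1`: continuous in `v` and bounded by `Σ_{n} n^{−3/2}` (`σ = 1/2`).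
[cite: Zhang2022LandauSiegel, §6 p. 32] -/
theorem continuous_tailPc_neg_one {s : ℂ} (hs : s.re = 1 / 2) (N : ℝ) :
    Continuous (fun v : ℝ => tailPc χ x N s (((-1 : ℝ) : ℂ) + (v : ℂ) * I)) ∧
      ∀ v : ℝ, ‖tailPc χ x N s (((-1 : ℝ) : ℂ) + (v : ℂ) * I)‖ ≤ ∑' n : ℕ, (n : ℝ) ^ (-(3 / 2 : ℝ)) := by
  have hsum : Summable fun n : ℕ => (n : ℝ) ^ (-(3 / 2 : ℝ)) :=
    Real.summable_nat_rpow.mpr (by norm_num)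
  set f : ℕ → ℝ → ℂ := fun n v =>
    if ⌈N⌉₊ ≤ n then conj (pc χ x n) * (n : ℂ) ^ (-(1 - s - (((-1 : ℝ) : ℂ) + (v : ℂ) * I))) else 0
    with hf
  have hfc : ∀ n, Continuous (f n) := by
    intro n
    by_cases h : ⌈N⌉₊ ≤ n
    · simp only [hf, if_pos h]
      rcases Nat.eq_zero_or_pos n with rfl | hn
      · refine continuous_const.mul ?_
        -- `0 ^ (…) ` is the constant `0`
        have : (fun v : ℝ => ((0 : ℕ) : ℂ) ^ (-(1 - s - (((-1 : ℝ) : ℂ) + (v : ℂ) * I)))) = fun _ => 0 := by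
          funext v
          have hne : (-(1 - s - (((-1 : ℝ) : ℂ) + (v : ℂ) * I))) ≠ 0 := by
            intro h0; have := congrArg Complex.re h0; simp [hs] at this; norm_num at this
          rw [Nat.cast_zero, Complex.zero_cpow hne]
        rw [this]; exact continuous_const
      · have hn0 : (n : ℂ) ≠ 0 := by exact_mod_cast hn.ne'
        exact continuous_const.mul (Continuous.const_cpow (by fun_prop) (Or.inl hn0))
    · simp only [hf, if_neg h]; exact continuous_const
  have hfb : ∀ n v, ‖f n v‖ ≤ (n : ℝ) ^ (-(3 / 2 : ℝ)) := by
    intro n v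
    by_cases h : ⌈N⌉₊ ≤ n
    · simp only [hf, if_pos h]; exact norm_refl_term_le χ x hs n v
    · simp only [hf, if_neg h, norm_zero]; exact Real.rpow_nonneg (Nat.cast_nonneg n) _
  have hdef : (fun v : ℝ => tailPc χ x N s (((-1 : ℝ) : ℂ) + (v : ℂ) * I)) = fun v => ∑' n, f n v := by
    funext v; rfl
  refine ⟨?_, fun v => ?_⟩
  · rw [hdef]; exact continuous_tsum hfc hsum hfb
  · have hsv : Summable fun n => ‖f n v‖ := Summable.of_nonneg_of_le (fun n => norm_nonneg _)
      (fun n => hfb n v) hsum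
    calc ‖tailPc χ x N s (((-1 : ℝ) : ℂ) + (v : ℂ) * I)‖ = ‖∑' n, f n v‖ := rfl
      _ ≤ ∑' n, ‖f n v‖ := norm_tsum_le_tsum_norm hsv
      _ ≤ ∑' n : ℕ, (n : ℝ) ^ (-(3 / 2 : ℝ)) := hsv.tsum_le_tsum (fun n => hfb n v) hsum

omit [NeZero D] in
/-- The kernel on `u = −1`: `|X^wω₁(w)/w| ≤ X⁻¹e^{1/(4𝓛³⁰)}·e^{−v²/(4𝓛³⁰)}`.
[cite: Zhang2022LandauSiegel, §6 p. 32 ("a trivial bound for `ω₁(w)`")] -/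
theorem norm_kern_neg_one_le {X : ℝ} (hX : 0 < X) (v : ℝ) :
    ‖kern D X (((-1 : ℝ) : ℂ) + (v : ℂ) * I)‖ ≤
      X⁻¹ * Real.exp (1 / (4 * ell D ^ 30)) * Real.exp (-(1 / (4 * ell D ^ 30)) * v ^ 2) := by
  rw [kern_neg_line hX 1 v, norm_neg, norm_kernel _ (inv_pos.mpr hX), Real.rpow_one]
  have hw : (1 : ℝ) ≤ ‖((1 : ℝ) : ℂ) + ((-v : ℝ) : ℂ) * I‖ := le_norm_line 1 (-v)
  have hsplit : Real.exp ((1 ^ 2 - (-v) ^ 2) / (4 * ell D ^ 30)) =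
      Real.exp (1 / (4 * ell D ^ 30)) * Real.exp (-(1 / (4 * ell D ^ 30)) * v ^ 2) := by
    rw [← Real.exp_add]; congr 1; ring
  rw [hsplit, div_le_iff₀ (lt_of_lt_of_le one_pos hw)]
  have h0 : 0 ≤ X⁻¹ * Real.exp (1 / (4 * ell D ^ 30)) * Real.exp (-(1 / (4 * ell D ^ 30)) * v ^ 2) := by
    positivity
  calc X⁻¹ * (Real.exp (1 / (4 * ell D ^ 30)) * Real.exp (-(1 / (4 * ell D ^ 30)) * v ^ 2))
      = X⁻¹ * Real.exp (1 / (4 * ell D ^ 30)) * Real.exp (-(1 / (4 * ell D ^ 30)) * v ^ 2) * 1 := by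
        ring
    _ ≤ X⁻¹ * Real.exp (1 / (4 * ell D ^ 30)) * Real.exp (-(1 / (4 * ell D ^ 30)) * v ^ 2) *
        ‖((1 : ℝ) : ℂ) + ((-v : ℝ) : ℂ) * I‖ := by gcongr

omit [NeZero D] in
/-- A quadratic times a Gaussian is integrable on `ℝ`. [folklore] -/
private theorem integrable_quad_mul_gauss {b : ℝ} (hb : 0 < b) (A : ℝ) :
    Integrable fun v : ℝ => (|v| + A) ^ 2 * Real.exp (-b * v ^ 2) := by
  have h2 : Integrable fun v : ℝ => v ^ 2 * Real.exp (-b * v ^ 2) := by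
    have := integrable_rpow_mul_exp_neg_mul_sq hb (s := 2) (by norm_num)
    refine this.congr (ae_of_all _ fun v => ?_)
    simp only [Real.rpow_two]
  have h1 : Integrable fun v : ℝ => |v| * Real.exp (-b * v ^ 2) := by
    have := (integrable_rpow_mul_exp_neg_mul_sq hb (s := 1) (by norm_num)).norm
    refine this.congr (ae_of_all _ fun v => ?_)
    simp only [Real.rpow_one, Real.norm_eq_abs, abs_mul, abs_of_pos (Real.exp_pos _)]
  have h0 := integrable_exp_neg_mul_sq hb
  have e : (fun v : ℝ => (|v| + A) ^ 2 * Real.exp (-b * v ^ 2)) = fun v =>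
      v ^ 2 * Real.exp (-b * v ^ 2) + 2 * A * (|v| * Real.exp (-b * v ^ 2)) +
        A ^ 2 * Real.exp (-b * v ^ 2) := by
    funext v
    have : (|v| + A) ^ 2 = v ^ 2 + 2 * A * |v| + A ^ 2 := by rw [add_sq, sq_abs]; ring
    rw [this]; ring
  rw [e]
  exact (h2.add (h1.const_mul _)).add (h0.const_mul _)

/-- **The (6.3)-integrand is integrable along `u = −1`** (for `χψ`, `σ = 1/2`): `|Z(−1/2+iτ,χψ)|`
has polynomial growth (the tree's `StripGrowth.exists_norm_Zfac_le`), the head is a Dirichlet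
polynomial, and `|ω₁(−1+iv)| = e^{(1−v²)/4𝓛³⁰}`. [cite: Zhang2022LandauSiegel, §6 (6.3) p. 32] -/
theorem integrable_integrandHead (hD : 2 ≤ D) {s : ℂ} (hs : s.re = 1 / 2) {X : ℝ} (hX : 0 < X)
    (N : ℝ) : Integrable fun v : ℝ => integrandHead χ x X N s (((-1 : ℝ) : ℂ) + (v : ℂ) * I) := by
  have hℓ : 0 < ell D := by
    have : (1 : ℝ) < D := by exact_mod_cast lt_of_lt_of_le (by norm_num) hD
    exact Real.log_pos this
  have hΛ : 0 < 4 * ell D ^ 30 := by positivity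
  set b : ℝ := 1 / (4 * ell D ^ 30) with hb
  have hb0 : 0 < b := by rw [hb]; positivity
  obtain ⟨G, hG0, hG⟩ := StripGrowth.exists_norm_Zfac_le (A := 1) le_rfl
  set k : ℕ := D * x.p with hk
  -- continuity
  have hcont : Continuous fun v : ℝ => integrandHead χ x X N s (((-1 : ℝ) : ℂ) + (v : ℂ) * I) := by
    have hZ := continuous_Zpc_line χ x (s := s) (c := -1) (by rw [hs]; norm_num)
    have hH := continuous_headPc_line χ x N s (-1)
    have hK : Continuous fun v : ℝ => kern D X (((-1 : ℝ) : ℂ) + (v : ℂ) * I) := by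
      have e : (fun v : ℝ => kern D X (((-1 : ℝ) : ℂ) + (v : ℂ) * I)) =
          fun v => -kernel (ell D ^ 30) 1 X⁻¹ (-v) := by
        funext v; exact kern_neg_line hX 1 v
      rw [e]
      exact ((continuous_kernel (ell D ^ 30) one_ne_zero (inv_pos.mpr hX)).comp continuous_neg).neg
    unfold integrandHead
    exact (hZ.mul hH).mul hK
  -- the majorant
  set K : ℝ := G * (k : ℝ) ^ 2 * ⌈N⌉₊ * (X⁻¹ * Real.exp (1 / (4 * ell D ^ 30))) with hKdef
  have hK0 : 0 ≤ K := by rw [hKdef]; positivity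
  refine Integrable.mono' ((integrable_quad_mul_gauss hb0 (|s.im| + 2)).const_mul K)
    hcont.aestronglyMeasurable (ae_of_all _ fun v => ?_)
  -- pointwise bound
  have hz1 : -((1 : ℕ) : ℝ) ≤ (s + (((-1 : ℝ) : ℂ) + (v : ℂ) * I)).re := by simp [hs]
  have hz2 : (s + (((-1 : ℝ) : ℂ) + (v : ℂ) * I)).re ≤ 0 := by simp [hs]; norm_num
  have hZb := hG k (psiChi χ x) (s + (((-1 : ℝ) : ℂ) + (v : ℂ) * I)) hz1 hz2
  have him : |(s + (((-1 : ℝ) : ℂ) + (v : ℂ) * I)).im| + ((1 : ℕ) : ℝ) + 1 ≤ |v| + (|s.im| + 2) := by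
    simp only [Complex.add_im, Complex.ofReal_im, Complex.mul_im, Complex.ofReal_re, Complex.I_im,
      Complex.I_re, mul_zero, mul_one, zero_add, add_zero, Nat.cast_one]
    have := abs_add_le s.im v
    linarith
  have him0 : 0 ≤ |(s + (((-1 : ℝ) : ℂ) + (v : ℂ) * I)).im| + ((1 : ℕ) : ℝ) + 1 := by positivity
  have hZb' : ‖Zpc χ x (s + (((-1 : ℝ) : ℂ) + (v : ℂ) * I))‖ ≤
      G * (k : ℝ) ^ 2 * (|v| + (|s.im| + 2)) ^ 2 := by
    refine hZb.trans ?_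
    rw [show (1 + 1 : ℕ) = 2 from rfl]
    exact mul_le_mul_of_nonneg_left (pow_le_pow_left₀ him0 him 2) (by positivity)
  have hH := norm_headPc_neg_one_le χ x hs N v
  have hKb := norm_kern_neg_one_le (D := D) hX v
  rw [← hb] at hKb
  calc ‖integrandHead χ x X N s (((-1 : ℝ) : ℂ) + (v : ℂ) * I)‖
      = ‖Zpc χ x (s + (((-1 : ℝ) : ℂ) + (v : ℂ) * I))‖ * ‖headPc χ x N s (((-1 : ℝ) : ℂ) + (v : ℂ) * I)‖ *
          ‖kern D X (((-1 : ℝ) : ℂ) + (v : ℂ) * I)‖ := by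
        rw [integrandHead, norm_mul, norm_mul]
    _ ≤ (G * (k : ℝ) ^ 2 * (|v| + (|s.im| + 2)) ^ 2) * ⌈N⌉₊ *
          (X⁻¹ * Real.exp (1 / (4 * ell D ^ 30)) * Real.exp (-b * v ^ 2)) := by
        gcongr
    _ = K * ((|v| + (|s.im| + 2)) ^ 2 * Real.exp (-b * v ^ 2)) := by rw [hKdef]; ring

/-- **The (6.2)-integrand is integrable along `u = −1`** (for `χψ`, `σ = 1/2`).
[cite: Zhang2022LandauSiegel, §6 (6.2) p. 31] -/
theorem integrable_integrandTail (hD : 2 ≤ D) {s : ℂ} (hs : s.re = 1 / 2) {X : ℝ} (hX : 0 < X)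
    (N : ℝ) : Integrable fun v : ℝ => integrandTail χ x X N s (((-1 : ℝ) : ℂ) + (v : ℂ) * I) := by
  have hℓ : 0 < ell D := by
    have : (1 : ℝ) < D := by exact_mod_cast lt_of_lt_of_le (by norm_num) hD
    exact Real.log_pos this
  set b : ℝ := 1 / (4 * ell D ^ 30) with hb
  have hb0 : 0 < b := by rw [hb]; positivity
  obtain ⟨G, hG0, hG⟩ := StripGrowth.exists_norm_Zfac_le (A := 1) le_rfl
  obtain ⟨hTc, hTb⟩ := continuous_tailPc_neg_one χ x hs N
  set S : ℝ := ∑' n : ℕ, (n : ℝ) ^ (-(3 / 2 : ℝ)) with hS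
  have hS0 : 0 ≤ S := le_trans (norm_nonneg _) (hTb 0)
  set k : ℕ := D * x.p with hk
  have hcont : Continuous fun v : ℝ => integrandTail χ x X N s (((-1 : ℝ) : ℂ) + (v : ℂ) * I) := by
    have hZ := continuous_Zpc_line χ x (s := s) (c := -1) (by rw [hs]; norm_num)
    have hK : Continuous fun v : ℝ => kern D X (((-1 : ℝ) : ℂ) + (v : ℂ) * I) := by
      have e : (fun v : ℝ => kern D X (((-1 : ℝ) : ℂ) + (v : ℂ) * I)) =
          fun v => -kernel (ell D ^ 30) 1 X⁻¹ (-v) := by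
        funext v; exact kern_neg_line hX 1 v
      rw [e]
      exact ((continuous_kernel (ell D ^ 30) one_ne_zero (inv_pos.mpr hX)).comp continuous_neg).neg
    unfold integrandTail
    exact (hZ.mul hTc).mul hK
  set K : ℝ := G * (k : ℝ) ^ 2 * S * (X⁻¹ * Real.exp (1 / (4 * ell D ^ 30))) with hKdef
  refine Integrable.mono' ((integrable_quad_mul_gauss hb0 (|s.im| + 2)).const_mul K)
    hcont.aestronglyMeasurable (ae_of_all _ fun v => ?_)
  have hz1 : -((1 : ℕ) : ℝ) ≤ (s + (((-1 : ℝ) : ℂ) + (v : ℂ) * I)).re := by simp [hs]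
  have hz2 : (s + (((-1 : ℝ) : ℂ) + (v : ℂ) * I)).re ≤ 0 := by simp [hs]; norm_num
  have hZb := hG k (psiChi χ x) (s + (((-1 : ℝ) : ℂ) + (v : ℂ) * I)) hz1 hz2
  have him : |(s + (((-1 : ℝ) : ℂ) + (v : ℂ) * I)).im| + ((1 : ℕ) : ℝ) + 1 ≤ |v| + (|s.im| + 2) := by
    simp only [Complex.add_im, Complex.ofReal_im, Complex.mul_im, Complex.ofReal_re, Complex.I_im,
      Complex.I_re, mul_zero, mul_one, zero_add, add_zero, Nat.cast_one]
    have := abs_add_le s.im v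
    linarith
  have him0 : 0 ≤ |(s + (((-1 : ℝ) : ℂ) + (v : ℂ) * I)).im| + ((1 : ℕ) : ℝ) + 1 := by positivity
  have hZb' : ‖Zpc χ x (s + (((-1 : ℝ) : ℂ) + (v : ℂ) * I))‖ ≤
      G * (k : ℝ) ^ 2 * (|v| + (|s.im| + 2)) ^ 2 := by
    refine hZb.trans ?_
    rw [show (1 + 1 : ℕ) = 2 from rfl]
    exact mul_le_mul_of_nonneg_left (pow_le_pow_left₀ him0 him 2) (by positivity)
  have hKb := norm_kern_neg_one_le (D := D) hX v
  rw [← hb] at hKb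
  calc ‖integrandTail χ x X N s (((-1 : ℝ) : ℂ) + (v : ℂ) * I)‖
      = ‖Zpc χ x (s + (((-1 : ℝ) : ℂ) + (v : ℂ) * I))‖ * ‖tailPc χ x N s (((-1 : ℝ) : ℂ) + (v : ℂ) * I)‖ *
          ‖kern D X (((-1 : ℝ) : ℂ) + (v : ℂ) * I)‖ := by
        rw [integrandTail, norm_mul, norm_mul]
    _ ≤ (G * (k : ℝ) ^ 2 * (|v| + (|s.im| + 2)) ^ 2) * S *
          (X⁻¹ * Real.exp (1 / (4 * ell D ^ 30)) * Real.exp (-b * v ^ 2)) := by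
        gcongr
        exact hTb v
    _ = K * ((|v| + (|s.im| + 2)) ^ 2 * Real.exp (-b * v ^ 2)) := by rw [hKdef]; ring

/-- **The (6.4)-integrand is integrable along `u = −1`** (for `χψ`; `|R^{−w}| = R` there).
[cite: Zhang2022LandauSiegel, §6 (6.4) p. 32] -/
theorem integrable_integrandMain (hD : 2 ≤ D) {s : ℂ} (hs : s.re = 1 / 2) {X : ℝ} (hX : 0 < X)
    (hR : 0 < bigR D) (N : ℝ) :
    Integrable fun v : ℝ => integrandMain χ x X N s (((-1 : ℝ) : ℂ) + (v : ℂ) * I) := by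
  have hℓ : 0 < ell D := by
    have : (1 : ℝ) < D := by exact_mod_cast lt_of_lt_of_le (by norm_num) hD
    exact Real.log_pos this
  set b : ℝ := 1 / (4 * ell D ^ 30) with hb
  have hb0 : 0 < b := by rw [hb]; positivity
  have hRne : ((bigR D : ℝ) : ℂ) ≠ 0 := Complex.ofReal_ne_zero.mpr hR.ne'
  have hcont : Continuous fun v : ℝ => integrandMain χ x X N s (((-1 : ℝ) : ℂ) + (v : ℂ) * I) := by
    have hH := continuous_headPc_line χ x N s (-1)
    have hK : Continuous fun v : ℝ => kern D X (((-1 : ℝ) : ℂ) + (v : ℂ) * I) := by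
      have e : (fun v : ℝ => kern D X (((-1 : ℝ) : ℂ) + (v : ℂ) * I)) =
          fun v => -kernel (ell D ^ 30) 1 X⁻¹ (-v) := by
        funext v; exact kern_neg_line hX 1 v
      rw [e]
      exact ((continuous_kernel (ell D ^ 30) one_ne_zero (inv_pos.mpr hX)).comp continuous_neg).neg
    have hRp : Continuous fun v : ℝ => ((bigR D : ℝ) : ℂ) ^ (-(((-1 : ℝ) : ℂ) + (v : ℂ) * I)) :=
      Continuous.const_cpow (by fun_prop) (Or.inl hRne)
    unfold integrandMain
    exact ((continuous_const.mul hRp).mul hH).mul hK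
  set K : ℝ := ‖Zpc χ x s‖ * bigR D * ⌈N⌉₊ * (X⁻¹ * Real.exp (1 / (4 * ell D ^ 30))) with hKdef
  refine Integrable.mono' ((integrable_exp_neg_mul_sq hb0).const_mul K)
    hcont.aestronglyMeasurable (ae_of_all _ fun v => ?_)
  have hRn : ‖((bigR D : ℝ) : ℂ) ^ (-(((-1 : ℝ) : ℂ) + (v : ℂ) * I))‖ = bigR D := by
    rw [Complex.norm_cpow_eq_rpow_re_of_pos hR]; simp
  have hH := norm_headPc_neg_one_le χ x hs N v
  have hKb := norm_kern_neg_one_le (D := D) hX v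
  rw [← hb] at hKb
  calc ‖integrandMain χ x X N s (((-1 : ℝ) : ℂ) + (v : ℂ) * I)‖
      = ‖Zpc χ x s‖ * ‖((bigR D : ℝ) : ℂ) ^ (-(((-1 : ℝ) : ℂ) + (v : ℂ) * I))‖ *
          ‖headPc χ x N s (((-1 : ℝ) : ℂ) + (v : ℂ) * I)‖ * ‖kern D X (((-1 : ℝ) : ℂ) + (v : ℂ) * I)‖ := by
        rw [integrandMain, norm_mul, norm_mul, norm_mul]
    _ ≤ ‖Zpc χ x s‖ * bigR D * ⌈N⌉₊ *
          (X⁻¹ * Real.exp (1 / (4 * ell D ^ 30)) * Real.exp (-b * v ^ 2)) := by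
        rw [hRn]; gcongr
    _ = K * Real.exp (-b * v ^ 2) := by rw [hKdef]; ring

end BlockC

end Literature.NumberTheory.LFunctions.Zhang2022.Section11AFE
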